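import Summits.QuantumFields.YangMills.Theorems.SwapVirialDeficitSwapRingDeficit
import Summits.QuantumFields.YangMills.Theorems.LuscherReductionTwistedTraceScalingGaugeAverage
import Summits.QuantumFields.YangMills.Theorems.LuscherReductionRunningReductionTraceFormulaAveraging
import Summits.QuantumFields.YangMills.Theorems.FemtoTransferGapSlabGround
import HarnessLib

/-!
# The σ-glued ring: EXACT PAIRING OF THE SEAM SECTORS `z ↦ z + (1,1,0)` by the slice-wise centre flip
# (sector triage (C-a) for the sharp fixed-`L` σ-law — BC5 rung `stub_rung_fixedL` of LINE «sharp-sigma» on ⟨stmt-QuantumFields-24197⟩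
# `SwapVirialDeficit.SwapGluedStiffness`; LEAD ym-line-sfw-p2 g93's programme; free-hands support of ⟨24197⟩)

The centre flip `T₁ = twist 1 (−1)` (all direction-`1` links leaving the plane `x₁ = 0`), applied to EVERY slice of a ring history and leaving
the seam gauge field alone, preserves the a-priori measure `ringMeasure L` and every transfer kernel between consecutive slices
(✓`transferKernel_twist`: each time-like and each spatial plaquette meets the flipped links twice).  At the σ-SEAM the axis exchange turns
`T₁` into `T₀` (✓`configPerm_twist`), so the seam bond sees the mismatch `T₁T₀ = tw_{(1,1,0)}`:
★★ `swapRingDeficit_sliceFlip` — `F^S_z(T₁P) = F^S_{z+(1,1,0)}(P)` for every sector `z ∈ (ℤ/2)³` and every history `P`.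
Consequences (§3): ★★ `measureReal_swapDeficit_le_sliceFlip` (`μ_L{F^S_{z+(1,1,0)} ≤ u} = μ_L{F^S_z ≤ u}` for all `u`),
★★ `integral_comp_swapDeficit_sliceFlip` / `integral_exp_swapDeficit_sliceFlip` (`∫φ(F^S_{z+(1,1,0)}) = ∫φ(F^S_z)`, in particular the sector
Laplace integrals agree for every `b`), and (§4) ★★ `twistTrace_eq_quarter_sum_filter`: `Z^S_{L,b} = (1/4)·Σ_{z : z 0 = 0} e^{12bL⁴}∫e^{−bF^S_z}dμ_L`
— the eight σ-sectors collapse to the four classes `{000,110}, {010,100}, {001,111}, {011,101}`; with ✓`SwapRingSectors` (odd classes void near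
the valley, `z 2 = 1` classes subleading) the sharp fixed-`L` law of `Z^S` reduces to ONE sector law, that of `F^S_0`.
HONEST LABEL: exact finite-dimensional measure identities at fixed `L`; nothing about ⟨24197⟩/⟨24194⟩/⟨24497⟩/⟨24196⟩ (window-uniform statements)
or any rung is proved; the Yang–Mills mass gap is NOT proved; no summit is proved by a line.
Width seat ym-line-sfw-p2-w2 g55 (cell ym-idea-1, free hands; own crux ⟨22884⟩ blocked-on ⟨19935⟩), `--supports stmt-QuantumFields-24197`.
THEOREMS ONLY (0 `def`, 0 `sorry`), standard axioms.  References: [cite: tHooft1979]; [cite: Luscher1983, §2]; [cite: MontvayMunster1994, (3.145)]; [folklore].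
-/

set_option autoImplicit false

noncomputable section

open MeasureTheory Set
open scoped BigOperators ENNReal
open Literature.MathematicalPhysics.QuantumFieldTheory hiding SU2
open Literature.MathematicalPhysics.QuantumLattice

namespace Summit.QuantumFields.YangMills.Theorems.SwapVirialDeficit.SwapRing

open Summit.QuantumFields.YangMills.Theorems.FemtoTransferGap
open Summit.QuantumFields.YangMills.Theorems.FemtoTransferGap.TT
open Summit.QuantumFields.YangMills.Theorems.VirialFluxGap.RingDeficit
open Summit.QuantumFields.YangMills.Theorems.FemtoTransferGap.TwoLattice.Avg (twist_gaugeTransform twist_negOne_twist_negOne)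

variable {L : ℕ} [NeZero L]

/-! ## §1 The slice flip against the axis exchange, the composite twists and the transfer kernel -/

omit [NeZero L] in
/-- `σ ∘ T₁ = T₀ ∘ σ`: the axis exchange carries the direction-`1` centre flip to the direction-`0` one (✓`configPerm_twist`). [cite: tHooft1979] -/
theorem configPerm_swap_twist_one_negOne (U : GaugeConfig 3 L SU2) :
    configPerm (Equiv.swap (0 : Fin 3) 1) (twist 1 negOne U) = twist 0 negOne (configPerm (Equiv.swap (0 : Fin 3) 1) U) := by
  rw [configPerm_twist, Equiv.swap_apply_right]

omit [NeZero L] in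
/-- `tw_z ∘ T₀ = tw_{z + (1,0,0)}`. [folklore] -/
theorem twist3_twist_zero_negOne (z : Fin 3 → Bool) (X : GaugeConfig 3 L SU2) :
    twist3 z (twist 0 negOne X) = twist3 (fun k => Bool.xor (z k) (decide (k = 0))) X := by
  rw [show (negOne : SU2) = centreElem true from rfl, twist_centreElem_eq_twist3, twist3_twist3]
  congr 1
  funext k
  rw [Bool.and_true]

omit [NeZero L] in
/-- `T₁ ∘ tw_w = tw_{(0,1,0) + w}`. [folklore] -/
theorem twist_one_negOne_twist3 (w : Fin 3 → Bool) (X : GaugeConfig 3 L SU2) :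
    twist 1 negOne (twist3 w X) = twist3 (fun k => Bool.xor (decide (k = 1)) (w k)) X := by
  rw [show (negOne : SU2) = centreElem true from rfl, twist_centreElem_eq_twist3, twist3_twist3]
  congr 1
  funext k
  rw [Bool.and_true]

/-- Moving the flip across a transfer kernel: `K(T₁A, B) = K(A, T₁B)` (`T₁` is a central involution, ✓`transferKernel_twist`). [cite: tHooft1979] -/
theorem transferKernel_twist_one_negOne_left (β : ℝ) (A B : GaugeConfig 3 L SU2) :
    transferKernel su2Rep β (twist 1 negOne A) B = transferKernel su2Rep β A (twist 1 negOne B) := by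
  conv_lhs => rw [← twist_negOne_twist_negOne 1 B]
  rw [transferKernel_twist su2Rep β 1 negOne_mem_center]

/-- The bit bookkeeping `(0,1,0) + (z + (1,0,0)) = z + (1,1,0)`. [folklore] -/
theorem xor_one_xor_zero_eq (z : Fin 3 → Bool) :
    (fun k : Fin 3 => Bool.xor (decide (k = 1)) (Bool.xor (z k) (decide (k = 0)))) = fun k => Bool.xor (z k) (decide (k ≠ 2)) := by
  funext k
  fin_cases k <;> simp

/-- ★ **The seam bond after the slice flip**: `K(T₁U_last, g·tw_z(σ(T₁U₀))) = K(U_last, g·tw_{z+(1,1,0)}(σU₀))`. [cite: tHooft1979] [cite: Luscher1983, §2] -/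
theorem seamKernel_sliceFlip (β : ℝ) (z : Fin 3 → Bool) (U₀ Ulast : GaugeConfig 3 L SU2) (g : Site 3 L → SU2) :
    transferKernel su2Rep β (twist 1 negOne Ulast)
        (gaugeTransform g (twist3 z (configPerm (Equiv.swap (0 : Fin 3) 1) (twist 1 negOne U₀)))) =
      transferKernel su2Rep β Ulast
        (gaugeTransform g (twist3 (fun k => Bool.xor (z k) (decide (k ≠ 2))) (configPerm (Equiv.swap (0 : Fin 3) 1) U₀))) := by
  rw [configPerm_swap_twist_one_negOne, twist3_twist_zero_negOne, transferKernel_twist_one_negOne_left,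
    twist_gaugeTransform negOne_mem_center, twist_one_negOne_twist3, xor_one_xor_zero_eq]

/-! ## §2 The σ-glued exponent and deficit under the slice flip -/

/-- ★★ **`Ψ^S_z(T₁P) = Ψ^S_{z+(1,1,0)}(P)`**: the chain of kernels is flip-invariant slot by slot (✓`transferKernel_twist`), the seam bond shifts the
sector by `(1,1,0)` (✓`seamKernel_sliceFlip`). [cite: tHooft1979] [cite: Luscher1983, §2] -/
theorem swapRingExponent_sliceFlip (z : Fin 3 → Bool) (P : (Fin (2 * L - 1 + 1) → GaugeConfig 3 L SU2) × (Site 3 L → SU2)) :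
    swapRingExponent L z ((fun i => twist 1 negOne (P.1 i)), P.2) = swapRingExponent L (fun k => Bool.xor (z k) (decide (k ≠ 2))) P := by
  unfold swapRingExponent
  congr 1
  congr 1
  · exact Finset.prod_congr rfl fun i _ => transferKernel_twist su2Rep 1 1 negOne_mem_center _ _
  · exact seamKernel_sliceFlip 1 z (P.1 0) (P.1 (Fin.last (2 * L - 1))) P.2

/-- ★★ **`F^S_z(T₁P) = F^S_{z+(1,1,0)}(P)`** — the σ-glued action deficit pairs the seam sectors under the slice-wise centre flip.
[cite: tHooft1979] [cite: Luscher1983, §2] -/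
theorem swapRingDeficit_sliceFlip (z : Fin 3 → Bool) (P : (Fin (2 * L - 1 + 1) → GaugeConfig 3 L SU2) × (Site 3 L → SU2)) :
    swapRingDeficit L z ((fun i => twist 1 negOne (P.1 i)), P.2) = swapRingDeficit L (fun k => Bool.xor (z k) (decide (k ≠ 2))) P := by
  unfold swapRingDeficit
  rw [swapRingExponent_sliceFlip]

/-- The pairing is an involution on the sector labels: `(z + (1,1,0)) + (1,1,0) = z`. [folklore] -/
theorem xor_ne_two_xor_ne_two (z : Fin 3 → Bool) :
    (fun k : Fin 3 => Bool.xor (Bool.xor (z k) (decide (k ≠ 2))) (decide (k ≠ 2))) = z := by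
  funext k
  rw [Bool.xor_assoc, Bool.xor_self, Bool.xor_false]

/-! ## §3 The slice flip preserves the ring measure; paired sublevel volumes and Laplace integrals -/

/-- ★ **The slice-wise centre flip preserves `ringMeasure L`** (product of left translations on the flipped links, identity elsewhere and on the
seam field). [cite: MontvayMunster1994, (3.145)] -/
theorem measurePreserving_sliceFlip :
    MeasurePreserving (fun P : (Fin (2 * L - 1 + 1) → GaugeConfig 3 L SU2) × (Site 3 L → SU2) => ((fun i => twist 1 negOne (P.1 i)), P.2))
      (ringMeasure L) (ringMeasure L) := by
  haveI : IsProbabilityMeasure (gaugeMeasure L) := isProbabilityMeasure_gaugeMeasure (L := L)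
  have h1 : MeasurePreserving (fun U : Fin (2 * L - 1 + 1) → GaugeConfig 3 L SU2 => fun i => twist 1 negOne (U i))
      (Measure.pi fun _ : Fin (2 * L - 1 + 1) => configMeasure SU2 L) (Measure.pi fun _ : Fin (2 * L - 1 + 1) => configMeasure SU2 L) :=
    measurePreserving_pi (fun _ : Fin (2 * L - 1 + 1) => configMeasure SU2 L) (fun _ : Fin (2 * L - 1 + 1) => configMeasure SU2 L)
      fun _ => measurePreserving_twist 1 negOne
  have h := h1.prod (MeasurePreserving.id (gaugeMeasure L))
  have e : (Prod.map (fun U : Fin (2 * L - 1 + 1) → GaugeConfig 3 L SU2 => fun i => twist 1 negOne (U i)) id) =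
      fun P : (Fin (2 * L - 1 + 1) → GaugeConfig 3 L SU2) × (Site 3 L → SU2) => ((fun i => twist 1 negOne (P.1 i)), P.2) := by
    funext P; rfl
  rw [e] at h
  exact h

/-- ★★ **Paired sublevel volumes**: `μ_L{F^S_{z+(1,1,0)} ≤ u} = μ_L{F^S_z ≤ u}` for every `u`. [cite: tHooft1979] [cite: Luscher1983, §2] -/
theorem measureReal_swapDeficit_le_sliceFlip (z : Fin 3 → Bool) (u : ℝ) :
    (ringMeasure L).real {P | swapRingDeficit L (fun k => Bool.xor (z k) (decide (k ≠ 2))) P ≤ u} =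
      (ringMeasure L).real {P | swapRingDeficit L z P ≤ u} := by
  have hpre : (fun P : (Fin (2 * L - 1 + 1) → GaugeConfig 3 L SU2) × (Site 3 L → SU2) => ((fun i => twist 1 negOne (P.1 i)), P.2)) ⁻¹'
      {P | swapRingDeficit L z P ≤ u} = {P | swapRingDeficit L (fun k => Bool.xor (z k) (decide (k ≠ 2))) P ≤ u} := by
    ext P
    simp only [mem_preimage, mem_setOf_eq, swapRingDeficit_sliceFlip]
  rw [← hpre, measureReal_def, measureReal_def,
    (measurePreserving_sliceFlip (L := L)).measure_preimage
      (measurableSet_le (measurable_swapRingDeficit z) measurable_const).nullMeasurableSet]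

/-- The ENNReal form of the paired sublevel volumes. [folklore] -/
theorem measure_swapDeficit_le_sliceFlip (z : Fin 3 → Bool) (u : ℝ) :
    (ringMeasure L) {P | swapRingDeficit L (fun k => Bool.xor (z k) (decide (k ≠ 2))) P ≤ u} =
      (ringMeasure L) {P | swapRingDeficit L z P ≤ u} := by
  have hpre : (fun P : (Fin (2 * L - 1 + 1) → GaugeConfig 3 L SU2) × (Site 3 L → SU2) => ((fun i => twist 1 negOne (P.1 i)), P.2)) ⁻¹'
      {P | swapRingDeficit L z P ≤ u} = {P | swapRingDeficit L (fun k => Bool.xor (z k) (decide (k ≠ 2))) P ≤ u} := by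
    ext P
    simp only [mem_preimage, mem_setOf_eq, swapRingDeficit_sliceFlip]
  rw [← hpre, (measurePreserving_sliceFlip (L := L)).measure_preimage
    (measurableSet_le (measurable_swapRingDeficit z) measurable_const).nullMeasurableSet]

/-- ★★ **Paired integrals**: `∫ φ(F^S_{z+(1,1,0)}) dμ_L = ∫ φ(F^S_z) dμ_L` for every measurable `φ`. [cite: tHooft1979] [cite: Luscher1983, §2] -/
theorem integral_comp_swapDeficit_sliceFlip (z : Fin 3 → Bool) (φ : ℝ → ℝ) (hφ : Measurable φ) :
    ∫ P, φ (swapRingDeficit L (fun k => Bool.xor (z k) (decide (k ≠ 2))) P) ∂(ringMeasure L) =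
      ∫ P, φ (swapRingDeficit L z P) ∂(ringMeasure L) := by
  have h := measurePreserving_sliceFlip (L := L)
  have hg : AEStronglyMeasurable (fun P => φ (swapRingDeficit L z P))
      (Measure.map (fun P : (Fin (2 * L - 1 + 1) → GaugeConfig 3 L SU2) × (Site 3 L → SU2) =>
        ((fun i => twist 1 negOne (P.1 i)), P.2)) (ringMeasure L)) :=
    (hφ.comp (measurable_swapRingDeficit z)).aestronglyMeasurable
  calc ∫ P, φ (swapRingDeficit L (fun k => Bool.xor (z k) (decide (k ≠ 2))) P) ∂(ringMeasure L)
      = ∫ P, φ (swapRingDeficit L z ((fun i => twist 1 negOne (P.1 i)), P.2)) ∂(ringMeasure L) := by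
        simp_rw [swapRingDeficit_sliceFlip]
    _ = ∫ P, φ (swapRingDeficit L z P) ∂(Measure.map (fun P : (Fin (2 * L - 1 + 1) → GaugeConfig 3 L SU2) × (Site 3 L → SU2) =>
          ((fun i => twist 1 negOne (P.1 i)), P.2)) (ringMeasure L)) := (integral_map h.measurable.aemeasurable hg).symm
    _ = ∫ P, φ (swapRingDeficit L z P) ∂(ringMeasure L) := by rw [h.map_eq]

/-- ★★ **Paired sector Laplace integrals**: `∫ e^{−bF^S_{z+(1,1,0)}} dμ_L = ∫ e^{−bF^S_z} dμ_L` for every `b`. [cite: tHooft1979] [cite: Luscher1983, §2] -/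
theorem integral_exp_swapDeficit_sliceFlip (z : Fin 3 → Bool) (b : ℝ) :
    ∫ P, Real.exp (-(b * swapRingDeficit L (fun k => Bool.xor (z k) (decide (k ≠ 2))) P)) ∂(ringMeasure L) =
      ∫ P, Real.exp (-(b * swapRingDeficit L z P)) ∂(ringMeasure L) :=
  integral_comp_swapDeficit_sliceFlip z (fun x => Real.exp (-(b * x))) (Real.measurable_exp.comp (measurable_const.mul measurable_id).neg)

/-! ## §4 The σ-glued trace over the four sector classes -/

/-- ★★ **`Z^S_{L,b} = (1/4)·Σ_{z : z 0 = 0} e^{12bL⁴}∫e^{−bF^S_z}dμ_L`** — the sector sum of ✓`twistTrace_eq_sum_exp_mul_integral_deficit` folded along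
the pairing `z ↦ z + (1,1,0)` (a fixed-point-free involution exchanging `z 0 = 0` and `z 0 = 1`). [cite: tHooft1979] [cite: MontvayMunster1994, (3.145)] -/
theorem twistTrace_eq_quarter_sum_filter (b : ℝ) :
    TT.twistTrace L b (2 * L) = (1 / 4 : ℝ) * ∑ z ∈ (Finset.univ : Finset (Fin 3 → Bool)).filter (fun z => z 0 = false),
      Real.exp (12 * b * (L : ℝ) ^ 4) * ∫ p, Real.exp (-(b * swapRingDeficit L z p)) ∂(ringMeasure L) := by
  rw [twistTrace_eq_sum_exp_mul_integral_deficit]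
  set f : (Fin 3 → Bool) → ℝ := fun z => Real.exp (12 * b * (L : ℝ) ^ 4) * ∫ p, Real.exp (-(b * swapRingDeficit L z p)) ∂(ringMeasure L)
    with hf
  -- split the sum along `z 0` and fold the `z 0 = true` half onto the `z 0 = false` half
  have hsplit := (Finset.sum_filter_add_sum_filter_not (Finset.univ : Finset (Fin 3 → Bool)) (fun z => z 0 = false) f).symm
  have hfold : ∑ z ∈ (Finset.univ : Finset (Fin 3 → Bool)).filter (fun z => ¬ z 0 = false), f z =
      ∑ z ∈ (Finset.univ : Finset (Fin 3 → Bool)).filter (fun z => z 0 = false), f z := by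
    refine Finset.sum_nbij' (fun z k => Bool.xor (z k) (decide (k ≠ 2))) (fun z k => Bool.xor (z k) (decide (k ≠ 2))) ?_ ?_ ?_ ?_ ?_
    · intro z hz
      simp only [Finset.mem_filter, Finset.mem_univ, true_and] at hz ⊢
      cases h : z 0 <;> simp_all
    · intro z hz
      simp only [Finset.mem_filter, Finset.mem_univ, true_and] at hz ⊢
      simp [hz]
    · intro z _; exact xor_ne_two_xor_ne_two z
    · intro z _; exact xor_ne_two_xor_ne_two z
    · intro z _
      simp only [hf]
      rw [integral_exp_swapDeficit_sliceFlip]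
  rw [hsplit, hfold, ← two_mul]
  ring

end Summit.QuantumFields.YangMills.Theorems.SwapVirialDeficit.SwapRing

end
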